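import Mathlib
import Literature.Geometry.DiscreteGeometry.TwoShellPatterns
import Literature.Geometry.DiscreteGeometry.TwoShellIntegerModel
import Literature.Geometry.DiscreteGeometry.TwoShellPlacementCheck
import Literature.MathematicalPhysics.StatisticalMechanics.BarlowStacking
import Summits.AtomisticToContinuum.Crystallization.Theorems.PhononSlackCertificatesNearFieldConvexityStubLabelledPlacementTemplate

/-!
# Crux `PhononSlackCertificates.NearFieldConvexity` (stmt-13958), line `Sketch`, stub `stub_labelledPlacement` —
# piece ASSEMBLY-FROM-CONTEXT (`stub_labelledPlacementOfContext`)

The last step (P-E) of the wave-1 plan for `stub_labelledPlacement`, proved against an explicit interface so that the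
combinatorial pieces (pair soundness, cross-pivot consistency, context selection) can target it: IF the 18 pivots of a
good centre are LABELLED BY ONE GENUINE CONTEXT `κ` of the `√18` integer model — i.e. there is `ct` with
`P = hcp/fcc pattern`, a context `κ` of the corresponding genuine family, and for every pivot `v ∈ P` a goodness witness
`(a', A', P', f')` of the particle `f v` together with an injective labelling `lab : P' → ℤ³` by `κ.isSite` vectors,
adjacent to `v` (`lab w /√18 ≠ v`, within `3/2` of `v`) and metrically `2/5`-accurate in the centre's frame where the
stub asks for it — THEN the conclusion of `stub_labelledPlacement` holds: the template `(R, s)` is the realisation of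
`κ` (`stub_labelledPlacementTemplate`, p166136), and the site indices `(σm, σu, σw)` of a label are read off clause (iii)
of the realisation (`R (barlowPos 1 (√6/3) s m u w) = lab w /√18`) by choice.  Pure bookkeeping; all `[folklore]`.
-/

noncomputable section

open Literature.MathematicalPhysics.StatisticalMechanics Literature.Geometry.DiscreteGeometry
open Literature.Geometry.DiscreteGeometry.TwoShellCheck (Ctx IVec)

namespace Summit.AtomisticToContinuum.Crystallization.Theorems.PhononSlackNearFieldConvexity

/-- **Registered piece `stub_labelledPlacementOfContext` (ASSEMBLY-FROM-CONTEXT) of `stub_labelledPlacement`.**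
See the module docstring for the interface; the hypothesis is placed after the stub's own binders so that the
combinatorial pieces can be stated pointwise in the configuration. [folklore] -/
theorem stub_labelledPlacementOfContext :
    ∀ (N : ℕ) (x : Fin N → EuclideanSpace ℝ (Fin 3)) (i : Fin N),
      (∀ k : Fin N, dist (x k) (x i) ≤ 3 → IsTwoShellGood (1 / 20) (47 / 50) 1 x k) →
      ∀ (a : ℝ) (A : EuclideanSpace ℝ (Fin 3) →ₗᵢ[ℝ] EuclideanSpace ℝ (Fin 3)) (P : Finset (EuclideanSpace ℝ (Fin 3)))
        (f : EuclideanSpace ℝ (Fin 3) → Fin N),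
        47 / 50 ≤ a → a ≤ 1 → (P = fccTwoShellPattern ∨ P = hcpTwoShellPattern) →
        (∀ v ∈ P, f v ≠ i ∧ dist (x (f v)) (x i + a • A v) ≤ 1 / 20 * a) → Set.InjOn f ↑P →
        (∀ j : Fin N, j ≠ i → dist (x j) (x i) ≤ 3 / 2 * a → ∃ v ∈ P, f v = j) →
        (∃ (ct : Bool) (κ : Literature.Geometry.DiscreteGeometry.TwoShellCheck.Ctx),
          κ ∈ (if ct then [⟨0,0,1,1,0⟩,⟨0,0,1,1,2⟩,⟨0,2,1,1,0⟩,⟨0,2,1,1,2⟩] else [⟨0,0,2,1,0⟩,⟨0,0,2,1,2⟩,⟨0,1,2,1,0⟩,⟨0,1,2,1,2⟩,⟨1,0,2,1,0⟩,⟨1,0,2,1,2⟩,⟨1,1,2,1,0⟩,⟨1,1,2,1,2⟩,⟨2,0,2,1,0⟩,⟨2,0,2,1,2⟩,⟨2,1,2,1,0⟩,⟨2,1,2,1,2⟩,⟨3,0,2,1,0⟩,⟨3,0,2,1,2⟩,⟨3,1,2,1,0⟩,⟨3,1,2,1,2⟩] : List Literature.Geometry.DiscreteGeometry.TwoShellCheck.Ctx)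 ∧
          P = (if ct then hcpTwoShellPattern else fccTwoShellPattern) ∧
          ∀ v ∈ P, ∃ (a' : ℝ) (A' : EuclideanSpace ℝ (Fin 3) →ₗᵢ[ℝ] EuclideanSpace ℝ (Fin 3))
            (P' : Finset (EuclideanSpace ℝ (Fin 3))) (f' : EuclideanSpace ℝ (Fin 3) → Fin N)
            (lab : EuclideanSpace ℝ (Fin 3) → Literature.Geometry.DiscreteGeometry.TwoShellCheck.IVec),
            47 / 50 ≤ a' ∧ a' ≤ 1 ∧ (P' = fccTwoShellPattern ∨ P' = hcpTwoShellPattern) ∧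
            (∀ w ∈ P', f' w ≠ f v ∧ dist (x (f' w)) (x (f v) + a' • A' w) ≤ 1 / 20 * a') ∧ Set.InjOn f' ↑P' ∧
            (∀ k : Fin N, k ≠ f v → dist (x k) (x (f v)) ≤ 3 / 2 * a' → ∃ w ∈ P', f' w = k) ∧
            (∀ w ∈ P', κ.isSite (lab w) = true) ∧ Set.InjOn lab ↑P' ∧
            (∀ w ∈ P', (Real.sqrt 18)⁻¹ • intVec (lab w).toFun ≠ v ∧
              dist ((Real.sqrt 18)⁻¹ • intVec (lab w).toFun) v ≤ 3 / 2 ∧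
              ((‖(Real.sqrt 18)⁻¹ • intVec (lab w).toFun‖ ≤ 43 / 20 ∨ dist (x (f' w)) (x i) ≤ 2) →
                dist (x (f' w)) (x i + a • A ((Real.sqrt 18)⁻¹ • intVec (lab w).toFun)) ≤ 2 / 5))) →
        ∃ (R : EuclideanSpace ℝ (Fin 3) →ₗᵢ[ℝ] EuclideanSpace ℝ (Fin 3)) (s : ℤ → ℤ), IsHaggSeq s ∧
          (∀ v ∈ P, ∃ m u w : ℤ, R (barlowPos 1 (Real.sqrt 6 / 3) s m u w) = v) ∧
          (∀ m u w : ℤ, ‖barlowPos 1 (Real.sqrt 6 / 3) s m u w‖ ≤ 3 / 2 → barlowPos 1 (Real.sqrt 6 / 3) s m u w ≠ 0 →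
            R (barlowPos 1 (Real.sqrt 6 / 3) s m u w) ∈ P) ∧
          (∀ v ∈ P, ∃ (a' : ℝ) (A' : EuclideanSpace ℝ (Fin 3) →ₗᵢ[ℝ] EuclideanSpace ℝ (Fin 3))
            (P' : Finset (EuclideanSpace ℝ (Fin 3))) (f' : EuclideanSpace ℝ (Fin 3) → Fin N)
            (σm σu σw : EuclideanSpace ℝ (Fin 3) → ℤ),
            47 / 50 ≤ a' ∧ a' ≤ 1 ∧ (P' = fccTwoShellPattern ∨ P' = hcpTwoShellPattern) ∧
            (∀ w ∈ P', f' w ≠ f v ∧ dist (x (f' w)) (x (f v) + a' • A' w) ≤ 1 / 20 * a') ∧ Set.InjOn f' ↑P' ∧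
            (∀ k : Fin N, k ≠ f v → dist (x k) (x (f v)) ≤ 3 / 2 * a' → ∃ w ∈ P', f' w = k) ∧
            Set.InjOn (fun w => barlowPos 1 (Real.sqrt 6 / 3) s (σm w) (σu w) (σw w)) ↑P' ∧
            (∀ w ∈ P', R (barlowPos 1 (Real.sqrt 6 / 3) s (σm w) (σu w) (σw w)) ≠ v ∧
              dist (R (barlowPos 1 (Real.sqrt 6 / 3) s (σm w) (σu w) (σw w))) v ≤ 3 / 2 ∧
              ((‖barlowPos 1 (Real.sqrt 6 / 3) s (σm w) (σu w) (σw w)‖ ≤ 43 / 20 ∨ dist (x (f' w)) (x i) ≤ 2) →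
                dist (x (f' w)) (x i + a • A (R (barlowPos 1 (Real.sqrt 6 / 3) s (σm w) (σu w) (σw w)))) ≤ 2 / 5))) := by
  intro N x i _ a A P f _ _ _ _ _ _ hctx
  obtain ⟨ct, κ, hκ, hP, hpiv⟩ := hctx
  obtain ⟨R, s, hs, h1, h2, h3⟩ := stub_labelledPlacementTemplate ct κ hκ
  rw [← hP] at h1 h2
  refine ⟨R, s, hs, h1, h2, fun v hv => ?_⟩
  obtain ⟨a', A', P', f', lab, ha'1, ha'2, hP', hf', hinj', hcomp', hsite, hlabinj, hmet⟩ := hpiv v hv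
  -- site indices of the labels, by choice from clause (iii) of the realisation
  classical
  have hidx : ∀ w ∈ P', ∃ m u u' : ℤ, R (barlowPos 1 (Real.sqrt 6 / 3) s m u u') =
      (Real.sqrt 18)⁻¹ • intVec (lab w).toFun := fun w hw => h3 (lab w) (hsite w hw)
  let σm : EuclideanSpace ℝ (Fin 3) → ℤ := fun w => if hw : w ∈ P' then (hidx w hw).choose else 0
  let σu : EuclideanSpace ℝ (Fin 3) → ℤ := fun w => if hw : w ∈ P' then (hidx w hw).choose_spec.choose else 0
  let σw : EuclideanSpace ℝ (Fin 3) → ℤ := fun w =>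
    if hw : w ∈ P' then (hidx w hw).choose_spec.choose_spec.choose else 0
  have hσ : ∀ w ∈ P', R (barlowPos 1 (Real.sqrt 6 / 3) s (σm w) (σu w) (σw w)) =
      (Real.sqrt 18)⁻¹ • intVec (lab w).toFun := by
    intro w hw
    have := (hidx w hw).choose_spec.choose_spec.choose_spec
    simp only [σm, σu, σw, dif_pos hw]
    exact this
  refine ⟨a', A', P', f', σm, σu, σw, ha'1, ha'2, hP', hf', hinj', hcomp', ?_, ?_⟩
  · -- injectivity of the site labelling: apply `R` and use injectivity of `lab`
    intro w hw w' hw' heq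
    have heq' : R (barlowPos 1 (Real.sqrt 6 / 3) s (σm w) (σu w) (σw w)) =
        R (barlowPos 1 (Real.sqrt 6 / 3) s (σm w') (σu w') (σw w')) := congrArg R heq
    rw [hσ w hw, hσ w' hw'] at heq'
    have hpos : (0 : ℝ) < (Real.sqrt 18)⁻¹ := by positivity
    have hvec : intVec (lab w).toFun = intVec (lab w').toFun := smul_right_injective _ hpos.ne' heq'
    have hfun : (lab w).toFun = (lab w').toFun := by
      ext l
      have := congrArg (fun z : EuclideanSpace ℝ (Fin 3) => z l) hvec
      simp only [intVec] at this
      exact_mod_cast this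
    have hlab : lab w = lab w' := by
      have h0 := congrFun hfun 0
      have h1' := congrFun hfun 1
      have h2' := congrFun hfun 2
      simp [Literature.Geometry.DiscreteGeometry.TwoShellCheck.IVec.toFun] at h0 h1' h2'
      exact Prod.ext h0 (Prod.ext h1' h2')
    exact hlabinj hw hw' hlab
  · intro w hw
    obtain ⟨hne, hdist, hmetric⟩ := hmet w hw
    rw [hσ w hw]
    refine ⟨hne, hdist, fun hcond => hmetric ?_⟩
    rcases hcond with hnorm | hfar
    · left
      rw [← LinearIsometry.norm_map R, hσ w hw] at hnorm
      exact hnorm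
    · exact Or.inr hfar

end Summit.AtomisticToContinuum.Crystallization.Theorems.PhononSlackNearFieldConvexity
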